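import Summits.Ventures.PercRepro.ProfileGapMonoThresholdWeakAverageFull

/-!
# PercRepro — THE DELETION COUNT OF THE CO-RANK-`t` LEVEL SET AND THE UP-SETS OF A RANK-`1` SET, GENERIC IN `t`
(p5, gen 28; `proofs/P5-GM1.md` §29; tools for the weak averaged step at `(2, t)`, every `t`)

The `t = 3` tools of `ProfileGapMonoThresholdDeletionCount` / `ProfileGapMonoThresholdWeakAverageCharge`, typed
once for every co-rank threshold `t`:
* `card_filter_rk_erase_add_coloops_le_gen` — `#{z ∈ X : t ≤ ρ(X∖z)} + [ρ X = t] · #coloops X ≤ #X` (the members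
  of `X` whose erasure keeps the rank `≥ t` are all of `X` when `ρ X > t`, the non-coloops when `ρ X = t`);
* `sum_card_levelSetCoQ_delete_add_le` — the deletion count of the co-rank-`t` level set, untruncated:
  `Σ_{z ∈ E} #T_t(M ∖ z) + Σ_{S ∈ T_t} #S + Σ_{S ∈ T_t, ρ(E∖S) = t} #coloops(E∖S) ≤ #E · #T_t`,
  `T_t = levelSetCoQ M t u` (a member `S` of `T_t` survives the deletion of `z ∉ S` unless `ρ(E∖S) = t` and
  `z` is a coloop of `E ∖ S`);
* `insert_mem_levelSetCoQ_of_rankOne_gen` — the up-set `insert y B` of a rank-`1` set `B` with `ρ(E∖B) ≥ t + 1`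
  and `y ∉ clF N B` lies in `T_t` at level `2`.
Nothing here is asserted about the averaged step itself.
-/

open scoped Matroid

namespace PercRepro.Cogirth

open Finset ThmH Skew Shadow Profile

variable {α : Type} [DecidableEq α] {M : Matroid α} [M.Finite]

section Count

/-- **The survivors of `X` under one erasure, at the co-rank threshold `t`**:
`#{z ∈ X : t ≤ ρ(X∖z)} + [ρ X = t] · #coloops X ≤ #X`. -/
theorem card_filter_rk_erase_add_coloops_le_gen {X : Finset α} (hX : X ⊆ gr M) (t : ℕ) :
    (X.filter (fun z => t ≤ rk M (X.erase z))).card +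
      (if rk M X = t then (coloops M X).card else 0) ≤ X.card := by
  by_cases ht : rk M X = t
  · rw [if_pos ht]
    -- at `ρ X = t` the survivors are the non-coloops
    have hsub : X.filter (fun z => t ≤ rk M (X.erase z)) ⊆ X \ coloops M X := by
      intro z hz
      rw [mem_filter] at hz
      rw [mem_sdiff]
      refine ⟨hz.1, fun hc => ?_⟩
      have := rk_erase_of_mem_coloops hX hc
      omega
    have h1 := card_le_card hsub
    rw [card_sdiff_of_subset (coloops_subset X)] at h1
    have h2 := card_le_card (coloops_subset (M := M) X)
    omega
  · rw [if_neg ht, add_zero]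
    exact card_filter_le _ _

/-- **The deletion count of the co-rank-`t` level set, untruncated**:
`Σ_{z ∈ E} #T(M ∖ z) + Σ_{S ∈ T} #S + Σ_{S ∈ T, ρ(E∖S) = t} #coloops(E∖S) ≤ #E · #T` for `T = levelSetCoQ M t u`
(the pattern of `sum_card_levelSetCoQ_three_delete_add_le`, every `t`). -/
theorem sum_card_levelSetCoQ_delete_add_le (t u : ℕ) :
    ∑ z ∈ gr M, (levelSetCoQ (M ＼ ({z} : Set α)) t u).card +
      (∑ S ∈ levelSetCoQ M t u, S.card +
        ∑ S ∈ (levelSetCoQ M t u).filter (fun S => rk M (gr M \ S) = t), (coloops M (gr M \ S)).card) ≤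
      (gr M).card * (levelSetCoQ M t u).card := by
  have h1 : ∑ z ∈ gr M, (levelSetCoQ (M ＼ ({z} : Set α)) t u).card =
      ∑ S ∈ levelSetCoQ M t u, ((gr M \ S).filter (fun z => t ≤ rk M ((gr M \ S).erase z))).card := by
    simp only [levelSetCoQ_delete_eq_filter, card_eq_sum_ones]
    apply sum_comm'
    intro z S
    simp only [mem_filter, mem_sdiff]
    tauto
  have h2 : ∑ S ∈ (levelSetCoQ M t u).filter (fun S => rk M (gr M \ S) = t), (coloops M (gr M \ S)).card =
      ∑ S ∈ levelSetCoQ M t u, (if rk M (gr M \ S) = t then (coloops M (gr M \ S)).card else 0) := by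
    rw [sum_filter]
  rw [h1, h2, mul_comm, ← smul_eq_mul, ← sum_const, ← sum_add_distrib, ← sum_add_distrib]
  apply sum_le_sum
  intro S hS
  rw [mem_levelSetCoQ] at hS
  obtain ⟨⟨hSg, _⟩, _⟩ := hS
  have hX : gr M \ S ⊆ gr M := sdiff_subset
  have hc := card_filter_rk_erase_add_coloops_le_gen (M := M) hX t
  have hcard : (gr M \ S).card = (gr M).card - S.card := card_sdiff_of_subset hSg
  have hSle : S.card ≤ (gr M).card := card_le_card hSg
  omega

end Count

section UpSets

variable {N : Matroid α} [N.Finite]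

/-- **The up-set is a demanding rank-`2` set at every threshold**: `insert y B ∈ T_t` when `ρ(E∖B) ≥ t + 1` and
`y ∉ clF N B` (the pattern of `insert_mem_levelSetCoQ_of_rankOne`, every `t`). -/
theorem insert_mem_levelSetCoQ_of_rankOne_gen {B : Finset α} (hB : B ∈ Rq N 1) {t : ℕ}
    (ht : t + 1 ≤ rk N (gr N \ B)) {y : α} (hy : y ∈ gr N \ clF N B) : insert y B ∈ levelSetCoQ N t 2 := by
  have hBg : B ⊆ gr N := (mem_Rq.1 hB).1
  have hyg : y ∈ gr N := (mem_sdiff.1 hy).1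
  have hyB : y ∉ B := notMem_of_mem_sdiff_clF hBg hy
  rw [mem_levelSetCoQ]
  refine ⟨⟨insert_subset hyg hBg, eRk_eq_of_rk_eq_cq (rk_insert_eq_two_of_notMem_clF hB hy)⟩, ?_⟩
  rw [sdiff_insert_eq_erase]
  have hyX : y ∈ gr N \ B := mem_sdiff.2 ⟨hyg, hyB⟩
  have := rk_le_rk_erase_add_one (M := N) (X := gr N \ B) sdiff_subset hyX
  omega

end UpSets

end PercRepro.Cogirth
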